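/- Copyright: the b2b-balaban cell (near-miss cell 7), T⁴-continuum fan-out; row NE7b CRUX team (2), seat
t4-ne7b-formalise-leaf-02 (the row owner's INTERFACE REQUEST NE7b IR-41-5 «S12-W», leaf-02 part (E4) of `CLAIMS.log`
l.27398 — the pinned END over the memory-agnostic carrier).  Released under the licence of the surrounding project. -/
import Summits.QuantumFields.BalabanUV.T4Continuum.Support.HistoryRealiseCellsRunMultEndDW
import Summits.QuantumFields.BalabanUV.T4Continuum.Support.HistoryRealiseCellsRunPinnedT3b

/-!
# Realised histories: THE END OF RECORD v3′ UNDER THE TWO PINS, OVER THE MEMORY-AGNOSTIC CARRIER (`…RunW_pinnedT3bD`)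
(INTERFACE REQUEST NE7b IR-41-5 «S12-W», leaf-02 part, file E4; repair route R-41-a of R-OWNER-41-1)

Summits-side support leaf of the T⁴-continuum cell (rung (B)+1 on a FINITE torus only; NOT infinite volume, NOT the
mass gap, NOT the Clay statement; NOT a proof of the spine estimate NE7b, which is the cell's OWN estimate, NOT PRINTED
and NOT PROVED).  Row NE7b, route «COUNT» ∕ R-P1, row S12-W of `t4/b2b-balaban-t4-ne7b-p1/LEAVES-NE7b.md` (owner's
IR-41-5, `HOME/INBOX.md` l.651; leaf-02's fixed names `CLAIMS.log` l.27398): E4 = the W-twin of this seat's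
`HistoryRealiseCellsRunPinnedT3b` (p222798).

WHY.  The landed pinned END `hybridNE7_of_realisedDomainsRun_pinnedT3bD` reads H3 through `RealisedDomainsR …`, whose
geometric clause rests on `Realises` — renewal memory FROZEN, stop demanded AT the renewal index (the owner's located
MODEL findings F-ne7bp1g40-1 and #3, R-OWNER-40-2 ∕ R-OWNER-41-1; B16 = [Balaban1989LargeFieldII] pp. 383–384, B15 =
[Balaban1989LargeFieldI] pp. 177, 198 — manuscripts UNDER AUDIT, locators only, nothing asserted).  Repair route R-41-a:
the END must not depend on the readiness CONVENTION.  THIS FILE re-plugs the pinned END over leaf-03's memory-agnostic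
domains carrier `RealisedDomainsRW` (`HistoryRealiseWeakCells`, IR-41-4 (3)) and leaf-03's W-END of record v3′
`HistoryRealiseCellsRunMultEndDW.hybridNE7_of_realisedDomainsRunW_printedT3bD` (S12-W W7): statement = the landed one with
`RealisedDomainsR ↦ RealisedDomainsRW`, proof = the landed proof with `…Run_printedT3bD ↦ …RunW_printedT3bD`; the
thresholds (`γ₁ := min γ₁ᶠ γB`, `g₁ := min 1 (exp (−irThresholdTLE C F.L rr β₀ ∕ 2))`, `Em := max (em g) 0`) and the
by-name discharges (`HistoryFlow.flowSide_of_betaPertHyp`, `HistoryRealiseCellsRunPinned.beta0_le_of_L_mul_le` ∕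
`…le_log_inv_sq_of_le_exp` ∕ `…four_le_L` — all carrier-free) are UNCHANGED; the conclusion is BYTE-IDENTICAL.  The
landed END stays.  Append-only: nothing landed is edited.

WHAT.  **`hybridNE7_of_realisedDomainsRunW_pinnedT3bD`**.  [folklore] composition by name; no `def`, no `[cite:]` tag,
nothing printed asserted, no `Prop` fact minted (c1), zero `sorry`.  DISPLAYED: exactly as in the landed file (the module
docstring of `HistoryRealiseCellsRunPinnedT3b`), with H3 in its W-form.

HONEST.  END v3′ re-quantified over the W-carrier, not a new estimate; H3^NE7b (W-form), (B) and the BetaPertH-flow facts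
stay DISPLAYED ∕ pinned BY NAME; by-name class of every `WALL-NE7b-P1.md` §2 binder UNCHANGED; headline p224237 UNCHANGED
BY NAME; NE7b NOT proved; spine 0∕9.  HONEST DEPENDENCY (cell): continuum YM on T⁴ ⇐ BetaPertH ∧ nine spine estimates
(0/9 proved); BetaPertH ⇐ (D1) ∧ (D4) ∧ CAP+tail; G-an2-4 gates asym, D1 and NE2/3/4.  This file changes none of it. -/

open Finset MeasureTheory
open Literature.MathematicalPhysics.QuantumFieldTheory.Balaban1983to89
open T4PersistenceDictionary T4PersistentHistoryCount T4BankedInduction T4PrintedShapeBanking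
open T4WeightBudget T4GlobalDenominator T4LiveClassFibration T4LiveStructureGas T4LiveGasToTerms T4RecordPriceSeam
open T4PartnerMultiplicity T4IndicatorShell T4MatchingAssembly T4MatchingClosure T4MatchingClosureSocket T4Continuum
open T4StabilitySocket T4BranchingRecordsGas T4TaggedShapeBanking T4CanonicalMenus T4RenewalChains
open Summit.QuantumFields.BalabanUV.T4Continuum.PlacementBatch
open Summit.QuantumFields.BalabanUV.T4Continuum.PlacementSkeleton
open Summit.QuantumFields.BalabanUV.T4Continuum.CountThresholdUniform
open Summit.QuantumFields.BalabanUV.T4Continuum.CountThresholdExit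
open Summit.QuantumFields.BalabanUV.T4Continuum.CountSeamJunction
open Summit.QuantumFields.BalabanUV.T4Continuum.LateMergers
open Summit.QuantumFields.BalabanUV.T4Continuum.HistoryFlow
open Summit.QuantumFields.BalabanUV.T4Continuum.HistoryRegeneration
open Summit.QuantumFields.BalabanUV.T4Continuum.HistoryTables
open Summit.QuantumFields.BalabanUV.T4Continuum.HistoryAssemblyTrees
open Summit.QuantumFields.BalabanUV.T4Continuum.HistoryAssemblyTerms
open Summit.QuantumFields.BalabanUV.T4Continuum.HistoryAssemblyPedigree
open Summit.QuantumFields.BalabanUV.T4Continuum.HistoryConstants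
open Summit.QuantumFields.BalabanUV.T4Continuum.HistoryGen
open Literature.MathematicalPhysics.QuantumFieldTheory.Balaban1983to89.B13ScaleTransfer
open Summit.QuantumFields.BalabanUV.T4Continuum.ZoneSkeleton
open Summit.QuantumFields.BalabanUV.T4Continuum.HistorySocketTH
open Summit.QuantumFields.BalabanUV.T4Continuum.HistoryCaps
open Summit.QuantumFields.BalabanUV.T4Continuum.HistoryAssemblyPrice
open Summit.QuantumFields.BalabanUV.T4Continuum.HistoryBankingLE
open Summit.QuantumFields.BalabanUV.T4Continuum.HistoryExitLE
open Summit.QuantumFields.BalabanUV.T4Continuum.HistoryAssemblyTreesLE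
open Summit.QuantumFields.BalabanUV.T4Continuum.HistoryAssemblyTermsLE
open Summit.QuantumFields.BalabanUV.T4Continuum.HistoryRealise
open Summit.QuantumFields.BalabanUV.T4Continuum.HistoryAssemblyRealiseLE
open Summit.QuantumFields.BalabanUV.T4Continuum.HistoryAssemblyMult
open Summit.QuantumFields.BalabanUV.T4Continuum.HistoryAssemblyMultKey
open Summit.QuantumFields.BalabanUV.T4Continuum.HistoryAssemblyRealiseRun
open Summit.QuantumFields.BalabanUV.T4Continuum.HistoryAssemblyRealiseMult
open Summit.QuantumFields.BalabanUV.T4Continuum.HistoryZones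
open Summit.QuantumFields.BalabanUV.T4Continuum.HistoryRealiseCells
open Summit.QuantumFields.BalabanUV.T4Continuum.HistoryRealiseCellsRun
open Summit.QuantumFields.BalabanUV.T4Continuum.HistoryAssemblyRealiseRunMult

open Summit.QuantumFields.BalabanUV.T4Continuum.HistoryRealiseCellsRunMult
open Summit.QuantumFields.BalabanUV.T4Continuum.HistoryAssemblyMultInstance
open Summit.QuantumFields.BalabanUV.T4Continuum.HistoryJoinsPlacedMember
open Summit.QuantumFields.BalabanUV.T4Continuum.PlacementSkeleton
open Summit.QuantumFields.BalabanUV.T4Continuum.HistoryJoinsPlacedMult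
open Summit.QuantumFields.BalabanUV.T4Continuum.HistoryRealiseDistinct
open Summit.QuantumFields.BalabanUV.T4Continuum.HistoryRegionTemplates
open Summit.QuantumFields.BalabanUV.T4Continuum.HistoryCaps
open Summit.QuantumFields.BalabanUV.T4Continuum.HistoryZoneEvolve (cth)
open Literature.MathematicalPhysics.QuantumFieldTheory.Balaban1983to89.B16SProfile (DropCtl)

open Summit.QuantumFields.BalabanUV.T4Continuum.HistoryRealiseCellsRunMultEnd
open Summit.QuantumFields.BalabanUV.T4Continuum.HistoryRealiseCellsRunMultEndD

open Summit.QuantumFields.BalabanUV.T4Continuum.HistoryRealisePrint Summit.QuantumFields.BalabanUV.T4Continuum.HistoryRealiseWeak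
open Summit.QuantumFields.BalabanUV.T4Continuum.HistoryRealisePrintReading Summit.QuantumFields.BalabanUV.T4Continuum.HistoryRealiseWeakReading
open Summit.QuantumFields.BalabanUV.T4Continuum.HistoryRealisePrintCells Summit.QuantumFields.BalabanUV.T4Continuum.HistoryRealiseWeakCells
open Summit.QuantumFields.BalabanUV.T4Continuum.HistoryRealiseCellsRunPinnedT3b
open Summit.QuantumFields.BalabanUV.T4Continuum.HistoryRealiseCellsRunMultEndDW
namespace Summit.QuantumFields.BalabanUV.T4Continuum.HistoryRealiseCellsRunPinnedT3bW

noncomputable section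

universe u v w

section Pinned

variable {F : T4Family} {G : Type*} [GaugeGroup G] [MeasurableSpace G] [HaarData G] [RegularGaugeGroup G]

/-- **NE7b's COUNT EXIT — THE END OF RECORD v3′ OVER THE MEMORY-AGNOSTIC CARRIER, UNDER THE PINS `(B)` AND `BetaPertHyp`,
IN THE APEX QUANTIFIER ORDER** (W-twin: the landed `hybridNE7_of_realisedDomainsRun_pinnedT3bD` VERBATIM with the H3 binder
`RealisedDomainsRW …` in place of `RealisedDomainsR …` and leaf-03's W7 END `hybridNE7_of_realisedDomainsRunW_printedT3bD` in
place of `…Run_printedT3bD`; thresholds, discharges and the conclusion BYTE-IDENTICAL).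
`HistoryRealiseCellsRunMultEndD.hybridNE7_of_realisedDomainsRun_printedT3bD` (p222385) with: the six flow binders
`hb hlo hhi hγ hγβ S` (+ `hp₀ hrr hβ`) DISCHARGED from `hβ : BetaPertHyp D.βfun` by `HistoryFlow.flowSide_of_betaPertHyp`
at the exponent `max C.p₀ rr`; the (B)-side witness `hcor : B16.Cor3With D.C γB em ep` + `γ ≤ γB` DISCHARGED from the pin
`hB : B16.EndStatementBPrinted D.C` (its `Cor3_250` conjunct); the infrared clause `hir` DISCHARGED on `]0, g₁]`,
`g₁ := min 1 (exp (−irThresholdTLE C F.L rr β₀ ∕ 2))`; `4 ≤ F.L` and `β₀ ≤ ½` from `T4Family.hL11` and `F.L·β₀ ≤ 1`.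
Quantifier order = `T4ContinuumYM4Torus.ForSmallCouplings` (with the (B)-constant `Em` after `g`): the thresholds are
fixed before the term index type `ι`, the payload types `α π` and all term data, which are bound inside; the
constants-only binders (`hA₀`, the slack `hθ hslack`, the instance's `hE₂ hE₃ hsS hsmall hθc0 hθc1 hθcs hθJ`, `hn₁`, `hn`)
stand in front.  Everything after `D.Tuned γ g g₀ →` is END v3′'s binder list verbatim, and the conclusion is its
conclusion with `max (em g) 0 ↦ Em`.  DISPLAYED: as in the module docstring.  NE7b NOT proved. [folklore] -/
theorem hybridNE7_of_realisedDomainsRunW_pinnedT3bD (D : FiniteEpsData F G)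
    -- the two pins, BY NAME, and the sign conventions of the datum
    (hB : B16.EndStatementBPrinted D.C) (hβ : BetaPertHyp D.βfun) (hsign : B16.SignConventions D.C)
    -- the constants (symbolic, c2∕c6) and their side conditions; NO `Dominates` on the slack road
    {C : T4PrintedShapeBanking.Consts} {O : PrintedO1s}
    {rr : ℕ} {β₀ : ℝ} (h : ThresholdOK C F.L rr β₀) (hμ : 0 < C.μ) (d n : ℕ)
    (hκ₁ : (d : ℝ) * Real.log F.L + 2 * Real.log 2 ≤ C.κ₁) (hE₀ : Real.log (2 + birthMass C) ≤ C.E₀)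
    (hA₀ : 1 ≤ C.A₀) (hβ₀ : 0 < β₀) (hLβ : (F.L : ℝ) * β₀ ≤ 1) (hn₁ : 13 ≤ C.n₁) (hn : 0 < n)
    -- the class-linear slack `C.a + θ ≤ ½γ₀A₁²` and row S6g′'s instance: stride `sS`, decay `θc`, their arithmetic side
    -- conditions, the signs of the floor ∕ size constants, and `θ` above the instance's class-linear constant (verbatim)
    {θ : ℝ} (hθ : 0 ≤ θ) (hslack : C.a + θ ≤ O.γ₀ * O.A₁ ^ 2 / 2)
    (hE₂ : 0 < C.E₂) (hE₃ : 0 ≤ C.E₃) {sS : ℕ} (hsS : 1 ≤ sS)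
    (hsmall : (((2 * cth 32 1 sS + 1) ^ d : ℕ) : ℝ) * (5 : ℝ) ^ d * ((max 1 (2 * 32 + 2) : ℕ) : ℝ) ≤
      (F.L : ℝ) ^ (sS / 2) / 2)
    {θc : ℝ} (hθc0 : 0 ≤ θc) (hθc1 : θc < 1) (hθcs : 1 / 2 ≤ θc ^ sS)
    (hθJ : (2 +
            ((2 * (((2 * cth 32 1 sS + 1) ^ d : ℕ) : ℝ) * ((((2 * 32 + 1) ^ d : ℕ) : ℝ) * (4 * 2 ^ d)) +
                  4 * ((((2 * cth 32 1 sS + 1) ^ d : ℕ) : ℝ) * (5 : ℝ) ^ d)) / (1 - θc) +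
              2 * (2 * ((((2 * cth 32 1 sS + 1) ^ d : ℕ) : ℝ) * (5 : ℝ) ^ d))) +
            (2 * ((0 + 2 * Real.log (2 * d + 1)) + (2 * (d : ℝ) + 2 * Real.log (2 * d + 1)) *
                  (((max 1 (2 * 32 + 2) : ℕ) : ℝ) * (2 * ((((2 * cth 32 1 sS + 1) ^ d : ℕ) : ℝ) * (5 : ℝ) ^ d)))) +
              (2 * (d : ℝ) + 2 * Real.log (2 * d + 1)) * 1 *
                (((max 1 (2 * 32 + 2) : ℕ) : ℝ) *
                    ((2 * (((2 * cth 32 1 sS + 1) ^ d : ℕ) : ℝ) * ((((2 * 32 + 1) ^ d : ℕ) : ℝ) * (4 * 2 ^ d)) +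
                        4 * ((((2 * cth 32 1 sS + 1) ^ d : ℕ) : ℝ) * (5 : ℝ) ^ d)) / (1 - θc)) +
                  4 * 2 ^ d)) +
            10) + 8 * 2 ^ d * Real.log (2 * d + 1) ≤ θ) :
    ∃ γ₁ : ℝ, 0 < γ₁ ∧ ∀ γ : ℝ, 0 < γ → γ ≤ γ₁ → ∃ g₁ : ℝ, 0 < g₁ ∧ ∀ g : ℝ, 0 < g → g ≤ g₁ →
      ∃ Em : ℝ, 0 ≤ Em ∧ ∀ g₀ : ℕ → ℝ, D.Tuned γ g g₀ →
      ∀ {ι : Type u} [DecidableEq ι] {α : Type v} {π : Type w} [DecidableEq α] [DecidableEq π]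
        (l₀ vol : ℝ) (K₀ : ℕ) (T : ℕ → Finset ι) (A A' shA shB dead dead' : ℕ → ℝ → ι → ℝ)
        (nup mup : ℕ → ℝ → ℝ) (Nup : ℝ) (Cc Rr CcRec RrRec : ℕ → ℝ → ι → ℝ) (ν u s₂ q₀ r s Wsh : ℕ → ℝ)
        -- the observable and the two runs' (α) integral bounds, floors, site budgets, envelopes ((B) side, displayed)
        (obs : (K : ℕ) → GaugeField (F.P K) 0 G → ℝ) (B : ℝ),
        (∀ K, Measurable (obs K)) → (∀ K U, |obs K U| ≤ B) →
        (∀ K t, |t| ≤ l₀ → K₀ ≤ K →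
          ∫ U, Real.exp (t * obs K U) * D.dens K (g₀ K) 0 U ∂fieldMeasure (F.P K) 0 G ≤ ∑ τ ∈ T K, A K t τ) →
        (∀ K t, |t| ≤ l₀ → K₀ ≤ K →
          ∫ U, Real.exp (t * obs (K + 1) U) * D.dens (K + 1) (g₀ (K + 1)) 0 U ∂fieldMeasure (F.P (K + 1)) 0 G ≤
          ∑ τ ∈ T K, A' K t τ) →
      ∀ (c₀ n₁ : ℝ), 0 < c₀ → (∀ K, K₀ ≤ K → c₀ ≤ smallFieldMass D K (g₀ K)) →
        (∀ K, K₀ ≤ K → c₀ ≤ smallFieldMass D (K + 1) (g₀ (K + 1))) →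
        (∀ K, K₀ ≤ K → ((D.C ⟨K, F.m, g₀ K⟩).numSites K : ℝ) ≤ n₁) →
        (∀ K, K₀ ≤ K → ((D.C ⟨K + 1, F.m, g₀ (K + 1)⟩).numSites (K + 1) : ℝ) ≤ n₁) →
        0 ≤ Nup → (∀ K t, |t| ≤ l₀ → K₀ ≤ K → 0 ≤ nup K t ∧ nup K t ≤ Nup) →
        (∀ K t, |t| ≤ l₀ → K₀ ≤ K → 0 ≤ mup K t ∧ mup K t ≤ Nup) →
      -- the (2.5) side condition on the size function
      ∀ (R : ℕ → ℕ → ℕ), (∀ K s, s ≤ K → B14.IsRj F.L rr ((D.C ⟨K, F.m, g₀ K⟩).flow.g s) (R K s)) →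
        (∀ K, K₀ ≤ K → ∀ t, 1 ≤ R K t) →
      -- H3: the terms read as pedigrees REALISED BY THE RUN'S OWN PROFILE with their DOMAINS
      ∀ (ped : ℕ → ι → Pedigree α π) (cellP : ℕ → ι → π → Pt d × Finset (Pt d)) (liveC : ℕ → ι → Finset α)
        (Zd : ℕ → ι → α → Finset (Pt d)),
        RealisedDomainsRW F.L (runProfile F.L R) n K₀ R T ped cellP liveC Zd →
      -- H3: live components dated no later than the cutoff; DISJOINT partners at every join and BOXED constituents at
      -- their birth levels (row S1c-opt's reading clauses)
        (∀ K, K₀ ≤ K → ∀ τ ∈ T K, ∀ c ∈ liveC K τ, (ped K τ).step c ≤ K) →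
        (∀ K, K₀ ≤ K → ∀ τ ∈ T K, ∀ c ∈ liveC K τ, DisjointJoins ((ped K τ).toPGen (cellP K τ) c)) →
        (∀ K, K₀ ≤ K → ∀ τ ∈ T K, ∀ c ∈ liveC K τ,
          BoxedBirths n F.L K (levelOf (runProfile F.L R K) K) ((ped K τ).toPGen (cellP K τ) c)) →
      -- H3: realised per-step costs of the live members, read below the model's booked cost
      ∀ (κ κ' : ℕ → (Fin d → ℕ) × Gen (Lab α π) → Gen (Lab α π) → ℕ → ℝ),
        (∀ K, K₀ ≤ K → ∀ τ ∈ badTerms (memOf ped liveC (cellOfR n F.L (runProfile F.L R) ped cellP)) jhalf T K, ∀ q ∈ memOf ped liveC (cellOfR n F.L (runProfile F.L R) ped cellP) K τ,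
          ∀ m ∈ life (padW (dictWT Prod.fst (R K) C.n₁) 0) q.2,
          κ K q q.2 m ≤ costT Prod.fst C K (R K) q.2 m) →
        (∀ K, K₀ ≤ K → ∀ τ ∈ badTerms (memOf ped liveC (cellOfR n F.L (runProfile F.L R) ped cellP)) jhalf T K, ∀ q ∈ memOf ped liveC (cellOfR n F.L (runProfile F.L R) ped cellP) K τ,
          ∀ m ∈ life (padW (dictWT Prod.fst (R K) C.n₁) 0) q.2,
          κ' K q q.2 m ≤ costT Prod.fst C K (R K) q.2 m) →
      -- H3: the per-term price sentence over the named members in PRINT's currency, discounted by `exp(−Ξ)`; both runs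
      ∀ (FcM RfM FcM' RfM' : ℕ → Finset ((Fin d → ℕ) × Gen PEv × Multiset (PEv × ((Fin d → ℕ) × Finset (Pt d)))) → ℝ),
        (∀ K t, |t| ≤ l₀ → K₀ ≤ K → ∀ τ ∈ badTerms (memOf ped liveC (cellOfR n F.L (runProfile F.L R) ped cellP)) jhalf T K,
          FcM K (kmemOf ped liveC (cellOfR n F.L (runProfile F.L R) ped cellP) (physV n F.L hn (Nat.lt_of_lt_of_le Nat.zero_lt_two (two_le_L F))
          (fun K => tcap d (dcapOf Prod.fst T (memOf ped liveC (cellOfR n F.L (runProfile F.L R) ped cellP)) K))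
          (fun K => one_le_tcap d (dcapOf Prod.fst T (memOf ped liveC (cellOfR n F.L (runProfile F.L R) ped cellP)) K)) (runProfile F.L R) ped cellP) K τ) * RfM K (kmemOf ped liveC (cellOfR n F.L (runProfile F.L R) ped cellP) (physV n F.L hn (Nat.lt_of_lt_of_le Nat.zero_lt_two (two_le_L F))
          (fun K => tcap d (dcapOf Prod.fst T (memOf ped liveC (cellOfR n F.L (runProfile F.L R) ped cellP)) K))
          (fun K => one_le_tcap d (dcapOf Prod.fst T (memOf ped liveC (cellOfR n F.L (runProfile F.L R) ped cellP)) K)) (runProfile F.L R) ped cellP) K τ) ≤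
          ∏ q ∈ memOf ped liveC (cellOfR n F.L (runProfile F.L R) ped cellP) K τ,
          pshapeTH Prod.fst O C 1 1 (R K) (D.C ⟨K, F.m, g₀ K⟩).flow.g 0 (κ K q) q.2 * Real.exp (-(8 / C.E₂ * totalCostT Prod.fst C K (R K) q.2 + 4 * (partnerAges (PEv.step ∘ Prod.fst) q.2 : ℝ)))) →
        (∀ K t, |t| ≤ l₀ → K₀ ≤ K → ∀ τ ∈ badTerms (memOf ped liveC (cellOfR n F.L (runProfile F.L R) ped cellP)) jhalf T K,
          FcM' K (kmemOf ped liveC (cellOfR n F.L (runProfile F.L R) ped cellP) (physV n F.L hn (Nat.lt_of_lt_of_le Nat.zero_lt_two (two_le_L F))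
          (fun K => tcap d (dcapOf Prod.fst T (memOf ped liveC (cellOfR n F.L (runProfile F.L R) ped cellP)) K))
          (fun K => one_le_tcap d (dcapOf Prod.fst T (memOf ped liveC (cellOfR n F.L (runProfile F.L R) ped cellP)) K)) (runProfile F.L R) ped cellP) K τ) * RfM' K (kmemOf ped liveC (cellOfR n F.L (runProfile F.L R) ped cellP) (physV n F.L hn (Nat.lt_of_lt_of_le Nat.zero_lt_two (two_le_L F))
          (fun K => tcap d (dcapOf Prod.fst T (memOf ped liveC (cellOfR n F.L (runProfile F.L R) ped cellP)) K))
          (fun K => one_le_tcap d (dcapOf Prod.fst T (memOf ped liveC (cellOfR n F.L (runProfile F.L R) ped cellP)) K)) (runProfile F.L R) ped cellP) K τ) ≤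
          ∏ q ∈ memOf ped liveC (cellOfR n F.L (runProfile F.L R) ped cellP) K τ,
          pshapeTH Prod.fst O C 1 1 (R K) (D.C ⟨K, F.m, g₀ K⟩).flow.g 0 (κ' K q) q.2 * Real.exp (-(8 / C.E₂ * totalCostT Prod.fst C K (R K) q.2 + 4 * (partnerAges (PEv.step ∘ Prod.fst) q.2 : ℝ)))) →
      -- H3: the remaining `Regeneration` numerator readings, over the PHYSICAL member families (run A, then run B)
        (∀ K t, |t| ≤ l₀ → K₀ ≤ K →
          ∀ k ∈ badGMems (memOf ped liveC (cellOfR n F.L (runProfile F.L R) ped cellP)) jhalf T (kmemOf ped liveC (cellOfR n F.L (runProfile F.L R) ped cellP) (physV n F.L hn (Nat.lt_of_lt_of_le Nat.zero_lt_two (two_le_L F))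
          (fun K => tcap d (dcapOf Prod.fst T (memOf ped liveC (cellOfR n F.L (runProfile F.L R) ped cellP)) K))
          (fun K => one_le_tcap d (dcapOf Prod.fst T (memOf ped liveC (cellOfR n F.L (runProfile F.L R) ped cellP)) K)) (runProfile F.L R) ped cellP)) K,
          ∀ τ ∈ fibre (kmemOf ped liveC (cellOfR n F.L (runProfile F.L R) ped cellP) (physV n F.L hn (Nat.lt_of_lt_of_le Nat.zero_lt_two (two_le_L F))
          (fun K => tcap d (dcapOf Prod.fst T (memOf ped liveC (cellOfR n F.L (runProfile F.L R) ped cellP)) K))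
          (fun K => one_le_tcap d (dcapOf Prod.fst T (memOf ped liveC (cellOfR n F.L (runProfile F.L R) ped cellP)) K)) (runProfile F.L R) ped cellP)) T K k, A K t τ ≤ dead K t τ * FcM K k * nup K t) →
        (∀ K t, |t| ≤ l₀ → K₀ ≤ K →
          ∀ k ∈ badGMems (memOf ped liveC (cellOfR n F.L (runProfile F.L R) ped cellP)) jhalf T (kmemOf ped liveC (cellOfR n F.L (runProfile F.L R) ped cellP) (physV n F.L hn (Nat.lt_of_lt_of_le Nat.zero_lt_two (two_le_L F))
          (fun K => tcap d (dcapOf Prod.fst T (memOf ped liveC (cellOfR n F.L (runProfile F.L R) ped cellP)) K))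
          (fun K => one_le_tcap d (dcapOf Prod.fst T (memOf ped liveC (cellOfR n F.L (runProfile F.L R) ped cellP)) K)) (runProfile F.L R) ped cellP)) K,
          ∀ τ ∈ fibre (kmemOf ped liveC (cellOfR n F.L (runProfile F.L R) ped cellP) (physV n F.L hn (Nat.lt_of_lt_of_le Nat.zero_lt_two (two_le_L F))
          (fun K => tcap d (dcapOf Prod.fst T (memOf ped liveC (cellOfR n F.L (runProfile F.L R) ped cellP)) K))
          (fun K => one_le_tcap d (dcapOf Prod.fst T (memOf ped liveC (cellOfR n F.L (runProfile F.L R) ped cellP)) K)) (runProfile F.L R) ped cellP)) T K k, 0 ≤ dead K t τ) →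
        (∀ K t, |t| ≤ l₀ → K₀ ≤ K →
          ∀ k ∈ badGMems (memOf ped liveC (cellOfR n F.L (runProfile F.L R) ped cellP)) jhalf T (kmemOf ped liveC (cellOfR n F.L (runProfile F.L R) ped cellP) (physV n F.L hn (Nat.lt_of_lt_of_le Nat.zero_lt_two (two_le_L F))
          (fun K => tcap d (dcapOf Prod.fst T (memOf ped liveC (cellOfR n F.L (runProfile F.L R) ped cellP)) K))
          (fun K => one_le_tcap d (dcapOf Prod.fst T (memOf ped liveC (cellOfR n F.L (runProfile F.L R) ped cellP)) K)) (runProfile F.L R) ped cellP)) K,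
          ∑ τ ∈ fibre (kmemOf ped liveC (cellOfR n F.L (runProfile F.L R) ped cellP) (physV n F.L hn (Nat.lt_of_lt_of_le Nat.zero_lt_two (two_le_L F))
          (fun K => tcap d (dcapOf Prod.fst T (memOf ped liveC (cellOfR n F.L (runProfile F.L R) ped cellP)) K))
          (fun K => one_le_tcap d (dcapOf Prod.fst T (memOf ped liveC (cellOfR n F.L (runProfile F.L R) ped cellP)) K)) (runProfile F.L R) ped cellP)) T K k, dead K t τ ≤ RfM K k) →
        (∀ K t, |t| ≤ l₀ → K₀ ≤ K →
          ∀ k ∈ badGMems (memOf ped liveC (cellOfR n F.L (runProfile F.L R) ped cellP)) jhalf T (kmemOf ped liveC (cellOfR n F.L (runProfile F.L R) ped cellP) (physV n F.L hn (Nat.lt_of_lt_of_le Nat.zero_lt_two (two_le_L F))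
          (fun K => tcap d (dcapOf Prod.fst T (memOf ped liveC (cellOfR n F.L (runProfile F.L R) ped cellP)) K))
          (fun K => one_le_tcap d (dcapOf Prod.fst T (memOf ped liveC (cellOfR n F.L (runProfile F.L R) ped cellP)) K)) (runProfile F.L R) ped cellP)) K, 0 ≤ FcM K k) →
        (∀ K t, |t| ≤ l₀ → K₀ ≤ K →
          ∀ k ∈ badGMems (memOf ped liveC (cellOfR n F.L (runProfile F.L R) ped cellP)) jhalf T (kmemOf ped liveC (cellOfR n F.L (runProfile F.L R) ped cellP) (physV n F.L hn (Nat.lt_of_lt_of_le Nat.zero_lt_two (two_le_L F))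
          (fun K => tcap d (dcapOf Prod.fst T (memOf ped liveC (cellOfR n F.L (runProfile F.L R) ped cellP)) K))
          (fun K => one_le_tcap d (dcapOf Prod.fst T (memOf ped liveC (cellOfR n F.L (runProfile F.L R) ped cellP)) K)) (runProfile F.L R) ped cellP)) K,
          ∀ τ ∈ fibre (kmemOf ped liveC (cellOfR n F.L (runProfile F.L R) ped cellP) (physV n F.L hn (Nat.lt_of_lt_of_le Nat.zero_lt_two (two_le_L F))
          (fun K => tcap d (dcapOf Prod.fst T (memOf ped liveC (cellOfR n F.L (runProfile F.L R) ped cellP)) K))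
          (fun K => one_le_tcap d (dcapOf Prod.fst T (memOf ped liveC (cellOfR n F.L (runProfile F.L R) ped cellP)) K)) (runProfile F.L R) ped cellP)) T K k, A' K t τ ≤ dead' K t τ * FcM' K k * mup K t) →
        (∀ K t, |t| ≤ l₀ → K₀ ≤ K →
          ∀ k ∈ badGMems (memOf ped liveC (cellOfR n F.L (runProfile F.L R) ped cellP)) jhalf T (kmemOf ped liveC (cellOfR n F.L (runProfile F.L R) ped cellP) (physV n F.L hn (Nat.lt_of_lt_of_le Nat.zero_lt_two (two_le_L F))
          (fun K => tcap d (dcapOf Prod.fst T (memOf ped liveC (cellOfR n F.L (runProfile F.L R) ped cellP)) K))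
          (fun K => one_le_tcap d (dcapOf Prod.fst T (memOf ped liveC (cellOfR n F.L (runProfile F.L R) ped cellP)) K)) (runProfile F.L R) ped cellP)) K,
          ∀ τ ∈ fibre (kmemOf ped liveC (cellOfR n F.L (runProfile F.L R) ped cellP) (physV n F.L hn (Nat.lt_of_lt_of_le Nat.zero_lt_two (two_le_L F))
          (fun K => tcap d (dcapOf Prod.fst T (memOf ped liveC (cellOfR n F.L (runProfile F.L R) ped cellP)) K))
          (fun K => one_le_tcap d (dcapOf Prod.fst T (memOf ped liveC (cellOfR n F.L (runProfile F.L R) ped cellP)) K)) (runProfile F.L R) ped cellP)) T K k, 0 ≤ dead' K t τ) →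
        (∀ K t, |t| ≤ l₀ → K₀ ≤ K →
          ∀ k ∈ badGMems (memOf ped liveC (cellOfR n F.L (runProfile F.L R) ped cellP)) jhalf T (kmemOf ped liveC (cellOfR n F.L (runProfile F.L R) ped cellP) (physV n F.L hn (Nat.lt_of_lt_of_le Nat.zero_lt_two (two_le_L F))
          (fun K => tcap d (dcapOf Prod.fst T (memOf ped liveC (cellOfR n F.L (runProfile F.L R) ped cellP)) K))
          (fun K => one_le_tcap d (dcapOf Prod.fst T (memOf ped liveC (cellOfR n F.L (runProfile F.L R) ped cellP)) K)) (runProfile F.L R) ped cellP)) K,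
          ∑ τ ∈ fibre (kmemOf ped liveC (cellOfR n F.L (runProfile F.L R) ped cellP) (physV n F.L hn (Nat.lt_of_lt_of_le Nat.zero_lt_two (two_le_L F))
          (fun K => tcap d (dcapOf Prod.fst T (memOf ped liveC (cellOfR n F.L (runProfile F.L R) ped cellP)) K))
          (fun K => one_le_tcap d (dcapOf Prod.fst T (memOf ped liveC (cellOfR n F.L (runProfile F.L R) ped cellP)) K)) (runProfile F.L R) ped cellP)) T K k, dead' K t τ ≤ RfM' K k) →
        (∀ K t, |t| ≤ l₀ → K₀ ≤ K →
          ∀ k ∈ badGMems (memOf ped liveC (cellOfR n F.L (runProfile F.L R) ped cellP)) jhalf T (kmemOf ped liveC (cellOfR n F.L (runProfile F.L R) ped cellP) (physV n F.L hn (Nat.lt_of_lt_of_le Nat.zero_lt_two (two_le_L F))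
          (fun K => tcap d (dcapOf Prod.fst T (memOf ped liveC (cellOfR n F.L (runProfile F.L R) ped cellP)) K))
          (fun K => one_le_tcap d (dcapOf Prod.fst T (memOf ped liveC (cellOfR n F.L (runProfile F.L R) ped cellP)) K)) (runProfile F.L R) ped cellP)) K, 0 ≤ FcM' K k) →
      -- the seam's other inputs: NE7c's shell weight bound, NE7's core budget, four summable rates
        ShellWeightBound l₀ T A A' shA shB Wsh →
        ReindexedBudget l₀ vol T (fun K t τ => A K t τ - shA K t τ) (fun K t τ => A' K t τ - shB K t τ)
          (badOfClass (bstrOf Prod.fst (memOf ped liveC (cellOfR n F.L (runProfile F.L R) ped cellP))) T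
          (fun K _ => badClasses Prod.fst (memOf ped liveC (cellOfR n F.L (runProfile F.L R) ped cellP)) jhalf T K)) Cc Rr CcRec RrRec ν u s₂ q₀ r s →
        Summable r → Summable u → Summable s → Summable s₂ →
    ∃ K₁ K₂, K₀ ≤ K₁ ∧ HybridNE7 l₀ vol (fun K => T (K₁ + (K₂ + K))) (fun K => A (K₁ + (K₂ + K)))
      (fun K => A' (K₁ + (K₂ + K)))
      (fun K => badOfClass (bstrOf Prod.fst (memOf ped liveC (cellOfR n F.L (runProfile F.L R) ped cellP))) T
        (fun K _ => badClasses Prod.fst (memOf ped liveC (cellOfR n F.L (runProfile F.L R) ped cellP)) jhalf T K) (K₁ + (K₂ + K)))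
      (fun K => constOf l₀ B Em n₁ c₀ Nup *
        recordsBudget (birthMass C) C.κ₁ ((n : ℝ) ^ d) ((F.L : ℝ) ^ d) (Real.log 2) jhalf (K₁ + (K₂ + K)))
      (fun K => shA (K₁ + (K₂ + K))) (fun K => shB (K₁ + (K₂ + K))) (fun K => Wsh (K₁ + (K₂ + K)))
      (fun K => (r (K₁ + (K₂ + K)) + u (K₁ + (K₂ + K))) + (s (K₁ + (K₂ + K)) + s₂ (K₁ + (K₂ + K)))) := by
  -- thresholds: the flow side from `BetaPertHyp`, the (B) side from the pin, the infrared clause from `g₁`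
  obtain ⟨hβ₁, hβhalf⟩ := HistoryRealiseCellsRunPinned.beta0_le_of_L_mul_le (F := F) hLβ
  obtain ⟨γ₀, b, β', _hγ₀, hb, _hbβ, hlo, hhi, γf, hγf, hγf₀, hS⟩ :=
    flowSide_of_betaPertHyp D hβ hβ₀ hβ₁ hLβ (max C.p₀ rr)
  obtain ⟨γB, hγB, em, ep, hcor⟩ := hB.2
  refine ⟨min γf γB, lt_min hγf hγB, fun γ hγ hγle => ?_⟩
  obtain ⟨hSm, hγβ⟩ := hS γ hγ (hγle.trans (min_le_left _ _))
  refine ⟨min 1 (Real.exp (-(irThresholdTLE C F.L rr β₀) / 2)), lt_min one_pos (Real.exp_pos _),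
    fun g hg hgle => ⟨max (em g) 0, le_max_right _ _, fun g₀ ht => ?_⟩⟩
  have hir : irThresholdTLE C F.L rr β₀ ≤ Real.log (g ^ 2)⁻¹ :=
    HistoryRealiseCellsRunPinned.le_log_inv_sq_of_le_exp hg (hgle.trans (min_le_right _ _))
  intro ι _ α π _ _ l₀ vol K₀ T A A' shA shB dead dead' nup mup Nup Cc Rr CcRec RrRec ν u s₂ q₀ r s Wsh obs B hobs
    hbd hα hα' c₀ n₁ hc₀ hfloor hfloor' hsites hsites' hNup hnup hmup R hR hR1 ped cellP liveC Zd H hstep hDJ hBB κ κ' hκ hκ'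
    FcM RfM FcM' RfM' hPM hPM' upM deadM_nonneg resumM FM_nonneg upM' deadM'_nonneg resumM' FM'_nonneg hSh hTB hr hu hs hs₂
  exact hybridNE7_of_realisedDomainsRunW_printedT3bD D h hμ d n hκ₁ hE₀ hA₀ hb.le hlo hhi
    (hγle.trans ((min_le_left _ _).trans hγf₀)) hγβ hSm (le_max_left _ _) (le_max_right _ _) hβhalf ht hir hsign
    hcor (hγle.trans (min_le_right _ _)) hobs hbd hα hα' hc₀ hfloor hfloor' hsites hsites' hNup hnup hmup R hR
    (HistoryRealiseCellsRunPinned.four_le_L F) hn₁ hR1 ped cellP liveC Zd H hn hstep hDJ hBB hθ hslack hE₂ hE₃ hsS hsmall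
    hθc0 hθc1 hθcs hθJ κ κ' hκ hκ' hPM hPM' upM deadM_nonneg resumM FM_nonneg upM' deadM'_nonneg resumM' FM'_nonneg
    hSh hTB hr hu hs hs₂

end Pinned

end

end Summit.QuantumFields.BalabanUV.T4Continuum.HistoryRealiseCellsRunPinnedT3bW
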